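import Summits.MatrixMultiplication.OmegaCensus.STPPKernelListerOrderN1to9
import Summits.MatrixMultiplication.OmegaCensus.STPPKernelListerOrderN10to15
import Summits.MatrixMultiplication.OmegaCensus.STPPKernelListerOrderN16to20
import Summits.MatrixMultiplication.OmegaCensus.STPPKernelListerOrderN21to24
import Summits.MatrixMultiplication.OmegaCensus.STPPKernelListerOrderN25to27
import Summits.MatrixMultiplication.OmegaCensus.STPPKernelListerOrderN28to30
import Summits.MatrixMultiplication.OmegaCensus.STPPKernelListerOrderN31to32

/-!
# ω-census (abelian STPP census): **NO abelian group of order ≤ 32 admits a beating STPP family — KERNEL** (the order law of the kernel lister)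

HONEST FRAMING (pub-omega census; verbatim): lottery ticket; floor = certified bounds/negative ranges.
Census STRUCTURE (seat pub-omega-stpp-2 gen 30, 2026-08-29), family (b2).  Nothing here is progress on `ω` — the theorem EXCLUDES: for every finite
abelian group `H` with `|H| ≤ 32` (all 55 isomorphism types of abelian groups of order `1 … 32`), every `m` and every simultaneous-triple-product
family `(Aᵢ, Bᵢ, Cᵢ)_{i<m}` of `H` (CKSU Def. 5.1, the tree's `IsSTPP`), `Σᵢ |Aᵢ||Bᵢ||Cᵢ| ≤ |H|`; hence CKSU Thm. 5.5 (`Σᵢ (aᵢbᵢcᵢ)^{ω/3} ≤ Σ d_k^ω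
≤ |H|` for abelian `H`) yields no bound `ω < 3` from any abelian group of order `≤ 32`, whatever the number of triples.  Assembly by `interval_cases` of
the 32 order capstones `KLister.volume_le_of_card_eq_1 … _32` (`STPPKernelListerOrderN1to9` … `…N31to32`): each is the kernel lister's root
computation with the EMPTY dead list (tree laws only) fed to `KLister.volume_le_of_scan_nodead`.  The census grade of the B2 abelian cells of order
`≤ 32` thereby moves from ENGINE (×2–×4 search engines) to KERNEL, unconditional, all block counts, all entries.
-/

open Finset

namespace Summit.MatrixMultiplication.OmegaCensus.KLister

open Literature.Computability.AlgebraicComplexity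

/-- **ORDER LAW (kernel): no finite abelian group of order `≤ 32` admits a beating STPP family** — for every finite abelian group `H` with
`|H| ≤ 32`, every `m` and every STPP family `(Aᵢ, Bᵢ, Cᵢ)_{i<m}` of `H` (CKSU Def. 5.1), `Σᵢ |Aᵢ||Bᵢ||Cᵢ| ≤ |H|`.
[cite: CohnKleinbergSzegedyUmans2005, Def. 5.1, Thm. 5.5] -/
theorem volume_le_card_of_card_le_32 {H : Type*} [AddCommGroup H] [Fintype H] [DecidableEq H] (h32 : Fintype.card H ≤ 32)
    {m : ℕ} (A B C : Fin m → Finset H) (hS : IsSTPP A B C) : ∑ i, #(A i) * #(B i) * #(C i) ≤ Fintype.card H := by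
  obtain ⟨n, hn⟩ : ∃ n, Fintype.card H = n := ⟨_, rfl⟩
  have hpos : 0 < n := hn ▸ Fintype.card_pos
  rw [hn] at h32 ⊢
  interval_cases n
  exacts [volume_le_of_card_eq_1 hn A B C hS, volume_le_of_card_eq_2 hn A B C hS, volume_le_of_card_eq_3 hn A B C hS, volume_le_of_card_eq_4 hn A B C hS, volume_le_of_card_eq_5 hn A B C hS, volume_le_of_card_eq_6 hn A B C hS, volume_le_of_card_eq_7 hn A B C hS, volume_le_of_card_eq_8 hn A B C hS, volume_le_of_card_eq_9 hn A B C hS, volume_le_of_card_eq_10 hn A B C hS, volume_le_of_card_eq_11 hn A B C hS, volume_le_of_card_eq_12 hn A B C hS, volume_le_of_card_eq_13 hn A B C hS, volume_le_of_card_eq_14 hn A B C hS, volume_le_of_card_eq_15 hn A B C hS, volume_le_of_card_eq_16 hn A B C hS, volume_le_of_card_eq_17 hn A B C hS, volume_le_of_card_eq_18 hn A B C hS, volume_le_of_card_eq_19 hn A B C hS, volume_le_of_card_eq_20 hn A B C hS, volume_le_of_card_eq_21 hn A B C hS, volume_le_of_card_eq_22 hn A B C hS, volume_le_of_card_eq_23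 hn A B C hS, volume_le_of_card_eq_24 hn A B C hS, volume_le_of_card_eq_25 hn A B C hS, volume_le_of_card_eq_26 hn A B C hS, volume_le_of_card_eq_27 hn A B C hS, volume_le_of_card_eq_28 hn A B C hS, volume_le_of_card_eq_29 hn A B C hS, volume_le_of_card_eq_30 hn A B C hS, volume_le_of_card_eq_31 hn A B C hS, volume_le_of_card_eq_32 hn A B C hS]

end Summit.MatrixMultiplication.OmegaCensus.KLister
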